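import Summits.CriticalPhenomena.CardyFormulaZ2.Theses.CardyRotToConf
import Literature.Probability.RandomPlanarGeometry.SLESixHullLocalityNbhdProved
import HarnessLib

/-!
# Stub `stub_isLocal` of line `germ-label-transport` (crux `stmt-CriticalPhenomena-0698`): PROVED

The typed locality (`ChordalFamily.IsLocal`) of any family of chordal SLE₆ laws on Dobrushin domains —
the registered stub signature `∀ Q : ChordalFamily, (∀ D : DobrushinDomain, IsSLELaw 6 D (Q D)) → Q.IsLocal`
—, an instance of the Literature theorem `ChordalFamily.isLocal_of_isSLELaw_six_holds`
(`SLESixHullLocalityNbhdProved.lean`; Lawler–Schramm–Werner 2001, Thm. 2.2 / Cor. 2.4, restriction form: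
conformal-image chain of the SLE₆ trace under a bounded hull, vanishing drift at `κ = 6`, passage
through the finitely many swallow instants, Jordan reduction and buried targets).
-/

noncomputable section

open Literature.Probability.RandomPlanarGeometry

namespace Summit.CriticalPhenomena.CardyFormulaZ2.Theorems.CardyRotToConfR2SymmetryUpgrade

/-- **S3.** Every family of chordal SLE₆ laws on Dobrushin domains is local (`ChordalFamily.IsLocal`).
[cite: LawlerSchrammWerner2001, Cor 2.4] -/
theorem stub_isLocal : ∀ Q : ChordalFamily, (∀ D : DobrushinDomain, IsSLELaw 6 D (Q D)) → Q.IsLocal :=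
  fun _ hQ ↦ ChordalFamily.isLocal_of_isSLELaw_six_holds hQ

end Summit.CriticalPhenomena.CardyFormulaZ2.Theorems.CardyRotToConfR2SymmetryUpgrade

end
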